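import Literature.NumberTheory.Sieve.PolymathLcmSumsProofs

/-!
# Maynard (2016), Lemma 7 — translated sieve cutoffs and domination of their Fourier majorants

J. Maynard, *Large gaps between primes*, Ann. of Math. 183 (2016), §6, proof of Lemma 7 (the
paragraph before (6.33)).  Restricting `q` to a residue class modulo a prime `p` replaces, in the
main term, the sieve weights `λ_{d,e}` by the weights `λ_{p^S d, p^T e}`, i.e. the cutoffs
`F(t)` by the TRANSLATED cutoffs `F(t + log p / log x)` (and `G(t + log p / log y)`).  This file
records the analytic input that makes the weighted-`lcm` engine bound UNIFORM over such translates: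

* `IsSieveCutoff.translate` — `t ↦ F(t + u)` (`u ≥ 0`) is again a sieve cutoff with the same support
  bound;
* `expMulExt_translate` — for `F` vanishing on `(−∞, −δ)` and `0 ≤ u ≤ 1 − δ`,
  `Φ_{F(·+u)}(t) = e^{−u} Φ_F(t + u)` (`Φ_F = χ e^t F`, `expMulExt`);
* `IsSieveCutoff.norm_fourierWeight_translate` — hence `|f_{F(·+u)}(ξ)| = e^{−u} |f_F(ξ)| ≤ |f_F(ξ)|`
  (translation is a phase on the Fourier side);
* `LcmEuler.psiMaj_mono` — the majorants `ψ_j` of `PolymathLcmSumsProofs` are monotone in the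
  pointwise moduli of the Fourier weights, so translated data are dominated by the original data;
* `cutLeft`, `isSieveCutoff_cutLeft`, `cutLeft_eq` — the harmless normalisation `F ↦ χ₀ F`
  (`χ₀ = 1` on `[0, ∞)`, `= 0` on `(−∞, −1/2]`) making a cutoff vanish on `(−∞, −1/2)` without
  changing it on `[0, ∞)`.

## References

* J. Maynard, *Large gaps between primes*, Ann. of Math. (2) 183 (2016), 915–933; arXiv:1408.5110,
  §6, proof of Lemma 7 (before (6.33)). [Maynard2016LargeGaps]
* D.H.J. Polymath, *Variants of the Selberg sieve, and bounded intervals containing many primes*,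
  Res. Math. Sci. 1 (2014), Lemma 4.1 (proof). [Polymath8b2014]
-/

noncomputable section

open MeasureTheory Real Complex FourierTransform
open scoped BigOperators Topology SchwartzMap ContDiff

namespace Literature.NumberTheory.Sieve

/-! ### Translated cutoffs -/

/-- A translate `t ↦ F(t + u)`, `u ≥ 0`, of a sieve cutoff is a sieve cutoff with the same support
bound. [cite: Maynard2016LargeGaps, Lemma 7 (proof, before (6.33))] -/
theorem IsSieveCutoff.translate {F : ℝ → ℝ} {s : ℝ} (h : IsSieveCutoff F s) {u : ℝ} (hu : 0 ≤ u) :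
    IsSieveCutoff (fun t => F (t + u)) s where
  contDiff := h.contDiff.comp (contDiff_id.add contDiff_const)
  nonneg := h.nonneg
  eq_zero := fun t ht => h.eq_zero (t + u) (by linarith)

/-- **Translation of the extension**: if `F` vanishes on `(−∞, −δ)` and `0 ≤ u ≤ 1 − δ`, then
`Φ_{F(·+u)}(t) = e^{−u} Φ_F(t+u)` for all `t`. [cite: Maynard2016LargeGaps, Lemma 7 (proof, before (6.33))] -/
theorem expMulExt_translate {F : ℝ → ℝ} {δ u : ℝ} (hvan : ∀ t, t < -δ → F t = 0) (hu : 0 ≤ u)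
    (hu1 : u ≤ 1 - δ) (t : ℝ) :
    expMulExt (fun t => F (t + u)) t = Real.exp (-u) * expMulExt F (t + u) := by
  by_cases ht : F (t + u) = 0
  · simp only [expMulExt, ht, mul_zero]
  · have ht1 : -1 ≤ t := by
      by_contra h
      push Not at h
      exact ht (hvan _ (by linarith))
    rw [expMulExt_eq ht1, expMulExt_eq (by linarith : (-1 : ℝ) ≤ t + u), Real.exp_add]
    have h1 : Real.exp (-u) * Real.exp u = 1 := by rw [← Real.exp_add]; simp
    calc Real.exp t * F (t + u) = (Real.exp (-u) * Real.exp u) * (Real.exp t * F (t + u)) := by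
          rw [h1, one_mul]
      _ = Real.exp (-u) * (Real.exp t * Real.exp u * F (t + u)) := by ring

/-- **Translation is a phase on the Fourier side**: under the hypotheses of `expMulExt_translate`,
`|f_{F(·+u)}(ξ)| = e^{−u} |f_F(ξ)|`. [cite: Maynard2016LargeGaps, Lemma 7 (proof, before (6.33))] -/
theorem IsSieveCutoff.norm_fourierWeight_translate {F : ℝ → ℝ} {s δ u : ℝ} (h : IsSieveCutoff F s)
    (hvan : ∀ t, t < -δ → F t = 0) (hu : 0 ≤ u) (hu1 : u ≤ 1 - δ) (ξ : ℝ) :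
    ‖(h.translate hu).fourierWeight ξ‖ = Real.exp (-u) * ‖h.fourierWeight ξ‖ := by
  have hfun : ((h.translate hu).schwartzExt : ℝ → ℂ) =
      (Real.exp (-u) : ℂ) • ((h.schwartzExt : ℝ → ℂ) ∘ fun t => t + u) := by
    funext t
    simp only [IsSieveCutoff.schwartzExt_apply, Pi.smul_apply, Function.comp_apply, smul_eq_mul]
    rw [expMulExt_translate hvan hu hu1 t]
    push_cast
    ring
  rw [IsSieveCutoff.fourierWeight, IsSieveCutoff.fourierWeight, SchwartzMap.fourier_coe,
    SchwartzMap.fourier_coe, hfun]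
  have h2 : (𝓕 ((Real.exp (-u) : ℂ) • ((h.schwartzExt : ℝ → ℂ) ∘ fun t => t + u))) ξ =
      (Real.exp (-u) : ℂ) • ((𝐞 ((innerₗ ℝ) u ξ)) • (𝓕 (h.schwartzExt : ℝ → ℂ)) ξ) := by
    show VectorFourier.fourierIntegral 𝐞 volume (innerₗ ℝ)
        ((Real.exp (-u) : ℂ) • ((h.schwartzExt : ℝ → ℂ) ∘ fun t => t + u)) ξ = _
    rw [VectorFourier.fourierIntegral_const_smul, Pi.smul_apply,
      VectorFourier.fourierIntegral_comp_add_right]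
    rfl
  rw [h2, norm_smul, Circle.norm_smul, Complex.norm_real, Real.norm_eq_abs,
    abs_of_pos (Real.exp_pos _)]

/-- Hence the translate's Fourier weight is dominated pointwise by the original one.
[cite: Maynard2016LargeGaps, Lemma 7 (proof, before (6.33))] -/
theorem IsSieveCutoff.norm_fourierWeight_translate_le {F : ℝ → ℝ} {s δ u : ℝ}
    (h : IsSieveCutoff F s) (hvan : ∀ t, t < -δ → F t = 0) (hu : 0 ≤ u) (hu1 : u ≤ 1 - δ)
    (ξ : ℝ) : ‖(h.translate hu).fourierWeight ξ‖ ≤ ‖h.fourierWeight ξ‖ := by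
  rw [h.norm_fourierWeight_translate hvan hu hu1 ξ]
  have h1 : Real.exp (-u) ≤ 1 := by rw [Real.exp_le_one_iff]; linarith
  exact (mul_le_mul_of_nonneg_right h1 (norm_nonneg _)).trans (by rw [one_mul])

/-! ### Monotonicity of the majorants -/

namespace LcmEuler

variable {ι : Type*} [Fintype ι] [DecidableEq ι] {F G F₂ G₂ : ι → ℝ → ℝ} {sF sG sF₂ sG₂ : ι → ℝ}

omit [Fintype ι] [DecidableEq ι] in
/-- The majorants `ψ_j` are monotone in the moduli of the Fourier weights. [cite: Maynard2016LargeGaps, Lemma 7 (proof, before (6.33))] -/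
theorem psiMaj_mono (hF : ∀ j, IsSieveCutoff (F j) (sF j)) (hG : ∀ j, IsSieveCutoff (G j) (sG j))
    (hF₂ : ∀ j, IsSieveCutoff (F₂ j) (sF₂ j)) (hG₂ : ∀ j, IsSieveCutoff (G₂ j) (sG₂ j))
    (hf : ∀ j ξ, ‖(hF₂ j).fourierWeight ξ‖ ≤ ‖(hF j).fourierWeight ξ‖)
    (hg : ∀ j ξ, ‖(hG₂ j).fourierWeight ξ‖ ≤ ‖(hG j).fourierWeight ξ‖) (j : ι) (q : ℝ × ℝ) :
    psiMaj hF₂ hG₂ j q ≤ psiMaj hF hG j q := by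
  unfold psiMaj
  have h1 : 0 ≤ 1 + 2 * π * |q.1| := by positivity
  have h2 : 0 ≤ 1 + 2 * π * |q.2| := by positivity
  exact mul_le_mul (mul_le_mul_of_nonneg_left (hf j q.1) h1)
    (mul_le_mul_of_nonneg_left (hg j q.2) h2) (by positivity) (by positivity)

end LcmEuler

/-! ### Cutting a cutoff off on the left -/

/-- `χ₀(t) = smoothTransition (2t + 1)`: smooth, `= 1` on `[0, ∞)`, `= 0` on `(−∞, −1/2]`, values in
`[0,1]`. [cite: Maynard2016LargeGaps, Lemma 7 (proof, before (6.33))] -/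
def chi0 (t : ℝ) : ℝ := Real.smoothTransition (2 * t + 1)

/-- `χ₀ = 1` on `[0, ∞)`. [cite: Maynard2016LargeGaps, Lemma 7 (proof, before (6.33))] -/
theorem chi0_eq_one {t : ℝ} (ht : 0 ≤ t) : chi0 t = 1 :=
  Real.smoothTransition.one_of_one_le (by linarith)

/-- `χ₀ = 0` on `(−∞, −1/2]`. [cite: Maynard2016LargeGaps, Lemma 7 (proof, before (6.33))] -/
theorem chi0_eq_zero {t : ℝ} (ht : t ≤ -(1 / 2 : ℝ)) : chi0 t = 0 :=
  Real.smoothTransition.zero_of_nonpos (by linarith)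

/-- `0 ≤ χ₀`. [cite: Maynard2016LargeGaps, Lemma 7 (proof, before (6.33))] -/
theorem chi0_nonneg (t : ℝ) : 0 ≤ chi0 t := Real.smoothTransition.nonneg _

/-- `χ₀` is smooth. [cite: Maynard2016LargeGaps, Lemma 7 (proof, before (6.33))] -/
theorem contDiff_chi0 : ContDiff ℝ ∞ chi0 :=
  Real.smoothTransition.contDiff.comp ((contDiff_const.mul contDiff_id).add contDiff_const)

/-- The left cut `(χ₀ F)(t) = χ₀(t) F(t)`. [cite: Maynard2016LargeGaps, Lemma 7 (proof, before (6.33))] -/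
def cutLeft (F : ℝ → ℝ) (t : ℝ) : ℝ := chi0 t * F t

/-- `χ₀ F = F` on `[0, ∞)`. [cite: Maynard2016LargeGaps, Lemma 7 (proof, before (6.33))] -/
theorem cutLeft_eq {F : ℝ → ℝ} {t : ℝ} (ht : 0 ≤ t) : cutLeft F t = F t := by
  rw [cutLeft, chi0_eq_one ht, one_mul]

/-- `χ₀ F` vanishes on `(−∞, −1/2)`. [cite: Maynard2016LargeGaps, Lemma 7 (proof, before (6.33))] -/
theorem cutLeft_eq_zero {F : ℝ → ℝ} {t : ℝ} (ht : t < -(1 / 2 : ℝ)) : cutLeft F t = 0 := by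
  rw [cutLeft, chi0_eq_zero ht.le, zero_mul]

/-- `χ₀ F` is smooth if `F` is. [cite: Maynard2016LargeGaps, Lemma 7 (proof, before (6.33))] -/
theorem contDiff_cutLeft {F : ℝ → ℝ} (hF : ContDiff ℝ ∞ F) : ContDiff ℝ ∞ (cutLeft F) :=
  contDiff_chi0.mul hF

/-- `χ₀ F ≥ 0` if `F ≥ 0`. [cite: Maynard2016LargeGaps, Lemma 7 (proof, before (6.33))] -/
theorem cutLeft_nonneg {F : ℝ → ℝ} (hF : ∀ t, 0 ≤ F t) (t : ℝ) : 0 ≤ cutLeft F t :=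
  mul_nonneg (chi0_nonneg t) (hF t)

/-- `χ₀ F` is a sieve cutoff with the same support bound. [cite: Maynard2016LargeGaps, Lemma 7 (proof, before (6.33))] -/
theorem IsSieveCutoff.cutLeft {F : ℝ → ℝ} {s : ℝ} (h : IsSieveCutoff F s) :
    IsSieveCutoff (cutLeft F) s where
  contDiff := contDiff_cutLeft h.contDiff
  nonneg := h.nonneg
  eq_zero := fun t ht => by rw [Literature.NumberTheory.Sieve.cutLeft, h.eq_zero t ht, mul_zero]

/-- **The translated left-cut cutoff is dominated by the left-cut cutoff**: for `0 ≤ u ≤ 1/2`,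
`|f_{(χ₀F)(·+u)}(ξ)| ≤ |f_{χ₀F}(ξ)|`. [cite: Maynard2016LargeGaps, Lemma 7 (proof, before (6.33))] -/
theorem IsSieveCutoff.norm_fourierWeight_cutLeft_translate_le {F : ℝ → ℝ} {s u : ℝ}
    (h : IsSieveCutoff F s) (hu : 0 ≤ u) (hu1 : u ≤ 1 / 2) (ξ : ℝ) :
    ‖(h.cutLeft.translate hu).fourierWeight ξ‖ ≤ ‖h.cutLeft.fourierWeight ξ‖ :=
  h.cutLeft.norm_fourierWeight_translate_le (δ := 1 / 2) (fun _ ht => cutLeft_eq_zero ht) hu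
    (by linarith) ξ

end Literature.NumberTheory.Sieve
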